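import Literature.Geometry.Lorentzian.BogovskiiOperatorRegularity
import HarnessLib

/-!
# Regularity of the vector Bogovskiĭ-type operator `SV` in `x`

(trunk G08 = T-LORENTZ; family `gr`; namespace `Literature.Geometry.Lorentzian.MaoOhTao`.)

Mao–Oh–Tao (arXiv:2308.13031), Lemma 2.3: the kernel of the symmetric-divergence operator `T` is built from the
vector field `V^a(z) = w_y(|z|, z/|z|) z_a/|z|³` and from `K^{ab} = V^a z_b` (`BogovskiiVectorKernel.lean`,
`BogovskiiVectorOperator.lean`).  This file is the companion of `BogovskiiOperatorRegularity.lean` for the vector operator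
`(SV_η g)^a(x) = ∫ w_y(|x − y|, (x − y)/|x − y|) (x − y)_a/|x − y|³ g(y) dy` (kernel singularity `~ 1/|z|²`, still
integrable in `ℝ³`): continuity for `η, g ∈ C_c`, `C¹` with the derivative under the integral sign for `η, f ∈ C¹_c`,
and `∂_m SV_η f = SV_{∂_mη} f + SV_η ∂_m f` (`pd_bogovskiiVOperator`).

Everything is proved; no definitions, no named facts.

## References

* Y. Mao, S.-J. Oh, T. Tao, arXiv:2308.13031 (2023), Lemma 2.3, p. 8 (key `MaoOhTao2023`).
-/

noncomputable section

open scoped RealInnerProductSpace Topology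
open Filter MeasureTheory Set Metric Function

namespace Literature.Geometry.Lorentzian

namespace MaoOhTao

variable {η f : E3 → ℝ} {R : ℝ}

/-- `|z_a/|z|³| ≤ 1/|z|²`. [folklore] -/
theorem abs_vkernel_le (z : E3) (a : Fin 3) : |z a * (‖z‖ ^ 3)⁻¹| ≤ (‖z‖ ^ 2)⁻¹ := by
  by_cases hz : z = 0
  · subst hz; simp
  have hn : 0 < ‖z‖ := norm_pos_iff.2 hz
  have ha : |z a| ≤ ‖z‖ := by simpa using PiLp.norm_apply_le z a
  rw [abs_mul, abs_inv, abs_pow, abs_norm]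
  calc |z a| * (‖z‖ ^ 3)⁻¹ ≤ ‖z‖ * (‖z‖ ^ 3)⁻¹ := mul_le_mul_of_nonneg_right ha (by positivity)
    _ = (‖z‖ ^ 2)⁻¹ := by field_simp

/-- The dominating function `C 𝟙_{B̄_D}(z)/|z|²` is integrable on `ℝ³`. [folklore] -/
theorem integrable_indicator_inv_norm_sq (C D : ℝ) :
    Integrable fun z : E3 ↦ (closedBall (0 : E3) D).indicator (fun z ↦ C * (‖z‖ ^ 2)⁻¹) z := by
  refine (integrable_indicator_iff measurableSet_closedBall).2 ?_
  have h : IntegrableOn (fun z : E3 ↦ (‖z‖ ^ 2)⁻¹) (ball (0 : E3) (|D| + 1)) :=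
    integrableOn_ball_of_norm_le_rpow (by rw [finrank_euclideanSpace_fin]; norm_num) (C := 1) (α := 2)
      (by rw [finrank_euclideanSpace_fin]; norm_num)
      (Eventually.of_forall fun z ↦ by
        rw [Real.rpow_neg (norm_nonneg _), Real.rpow_two, one_mul, norm_inv, norm_pow, norm_norm])
      ((continuous_norm.pow 2).measurable.inv.aestronglyMeasurable)
  exact (h.mono_set (closedBall_subset_ball (by linarith [le_abs_self D]))).const_mul C

/-- The vector kernel `z_a/|z|³` is continuous off `z = 0`. [folklore] -/
theorem continuousOn_vkernel (a : Fin 3) : ContinuousOn (fun z : E3 ↦ z a * (‖z‖ ^ 3)⁻¹) {0}ᶜ :=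
  (EuclideanSpace.proj (𝕜 := ℝ) a).continuous.continuousOn.mul
    (ContinuousOn.inv₀ (continuous_norm.pow 3).continuousOn fun _ hz ↦
      pow_ne_zero 3 (norm_ne_zero_iff.2 (mem_compl_singleton_iff.1 hz)))

/-- **The operator in translated form**: `(SV_η g)^{a}(x) = ∫ w_{x−z}(|z|, z/|z|) z_a/|z|³ g(x − z) dz`. [folklore] -/
theorem bogovskiiVOperator_eq_translated (η g : E3 → ℝ) (x : E3) (a : Fin 3) :
    ∫ y : E3, bogovskiiWeight η y ‖x - y‖ (‖x - y‖⁻¹ • (x - y)) * ((x - y) a * (‖x - y‖ ^ 3)⁻¹) * g y =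
      ∫ z : E3, bogovskiiWeight η (x - z) ‖z‖ (‖z‖⁻¹ • z) * (z a * (‖z‖ ^ 3)⁻¹) * g (x - z) := by
  rw [← integral_sub_left_eq_self (fun y : E3 ↦ bogovskiiWeight η y ‖x - y‖ (‖x - y‖⁻¹ • (x - y)) *
    ((x - y) a * (‖x - y‖ ^ 3)⁻¹) * g y) volume x]
  refine integral_congr_ae (ae_of_all _ fun z ↦ ?_)
  simp only [sub_sub_cancel]

/-- **Pointwise bound for the translated integrand**: for `|x| ≤ X`, `g` vanishing off `B̄_{Rg}` with `|g| ≤ Mg`, and a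
weight bound `W` valid for base points of norm `≤ Rg`: `|w_{x−z} z_a/|z|³ g(x − z)| ≤ W Mg 𝟙_{|z| ≤ X + Rg}/|z|²`.
[folklore] -/
theorem abs_vtranslated_le (η : E3 → ℝ) {W Rg Mg X : ℝ} (hW0 : 0 ≤ W)
    (hW : ∀ y : E3, ‖y‖ ≤ Rg → ∀ (r : ℝ) (α : E3), ‖α‖ = 1 → |bogovskiiWeight η y r α| ≤ W)
    {g : E3 → ℝ} (hgR : ∀ y, g y ≠ 0 → ‖y‖ ≤ Rg) (hgM : ∀ y, |g y| ≤ Mg) {x : E3} (hx : ‖x‖ ≤ X) (z : E3)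
    (a : Fin 3) :
    |bogovskiiWeight η (x - z) ‖z‖ (‖z‖⁻¹ • z) * (z a * (‖z‖ ^ 3)⁻¹) * g (x - z)| ≤
      (closedBall (0 : E3) (X + Rg)).indicator (fun z ↦ W * Mg * (‖z‖ ^ 2)⁻¹) z := by
  have hMg : 0 ≤ Mg := (abs_nonneg _).trans (hgM 0)
  by_cases hg0 : g (x - z) = 0
  · rw [hg0, mul_zero, abs_zero]
    exact indicator_nonneg (fun z _ ↦ by positivity) _
  rw [indicator_of_mem (mem_closedBall_of_norm_sub_le hx (hgR _ hg0))]
  by_cases hz : z = 0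
  · subst hz; simp
  have hn : 0 < ‖z‖ := norm_pos_iff.2 hz
  have hw : |bogovskiiWeight η (x - z) ‖z‖ (‖z‖⁻¹ • z)| ≤ W :=
    hW _ (hgR _ hg0) _ _ (by rw [norm_smul, norm_inv, norm_norm, inv_mul_cancel₀ hn.ne'])
  rw [abs_mul, abs_mul]
  calc |bogovskiiWeight η (x - z) ‖z‖ (‖z‖⁻¹ • z)| * |z a * (‖z‖ ^ 3)⁻¹| * |g (x - z)|
      ≤ W * (‖z‖ ^ 2)⁻¹ * Mg := mul_le_mul (mul_le_mul hw (abs_vkernel_le z a) (abs_nonneg _) hW0)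
        (hgM _) (abs_nonneg _) (by positivity)
    _ = W * Mg * (‖z‖ ^ 2)⁻¹ := by ring

/-- The translated integrand is integrable (for `η, g ∈ C_c`). [folklore] -/
theorem integrable_vtranslated (hη : Continuous η) (hR : ∀ z : E3, R < ‖z‖ → η z = 0) {g : E3 → ℝ}
    (hg : Continuous g) (hgc : HasCompactSupport g) (x : E3) (a : Fin 3) :
    Integrable fun z : E3 ↦ bogovskiiWeight η (x - z) ‖z‖ (‖z‖⁻¹ • z) * (z a * (‖z‖ ^ 3)⁻¹) * g (x - z) := by
  obtain ⟨Rg, Mg, hgR, -, hgM⟩ := exists_radius_bound hg hgc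
  obtain ⟨W, hW⟩ := exists_abs_bogovskiiWeight_le_of_norm_le hη hR Rg
  refine (integrable_indicator_inv_norm_sq (max W 0 * Mg) (‖x‖ + Rg)).mono'
    (aestronglyMeasurable_of_continuousOn_compl_zero
      (((continuousOn_weight_translated hη hR x).mul (continuousOn_vkernel a)).mul
        ((hg.comp (continuous_const.sub continuous_id)).continuousOn))) (ae_of_all _ fun z ↦ ?_)
  rw [Real.norm_eq_abs]
  exact abs_vtranslated_le η (le_max_right _ _) (fun y hy r α hα ↦ (hW y hy r α hα).trans (le_max_left _ _))
    hgR hgM le_rfl z a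

/-- **`SV_η g` is continuous** for `η, g ∈ C_c` (dominated convergence in the translated form).
[cite: MaoOhTao2023, Lemma 2.3] -/
theorem continuous_bogovskiiVOperator (hη : Continuous η) (hR : ∀ z : E3, R < ‖z‖ → η z = 0) {g : E3 → ℝ}
    (hg : Continuous g) (hgc : HasCompactSupport g) (a : Fin 3) :
    Continuous fun x : E3 ↦ ∫ y : E3, bogovskiiWeight η y ‖x - y‖ (‖x - y‖⁻¹ • (x - y)) *
      ((x - y) a * (‖x - y‖ ^ 3)⁻¹) * g y := by
  simp only [bogovskiiVOperator_eq_translated]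
  obtain ⟨Rg, Mg, hgR, -, hgM⟩ := exists_radius_bound hg hgc
  obtain ⟨W, hW⟩ := exists_abs_bogovskiiWeight_le_of_norm_le hη hR Rg
  refine continuous_iff_continuousAt.2 fun x₀ ↦ ?_
  refine continuousAt_of_dominated (bound := fun z ↦ (closedBall (0 : E3) (‖x₀‖ + 1 + Rg)).indicator
    (fun z ↦ max W 0 * Mg * (‖z‖ ^ 2)⁻¹) z) ?_ ?_ (integrable_indicator_inv_norm_sq _ _) ?_
  · exact Eventually.of_forall fun x ↦ aestronglyMeasurable_of_continuousOn_compl_zero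
      (((continuousOn_weight_translated hη hR x).mul (continuousOn_vkernel a)).mul
        ((hg.comp (continuous_const.sub continuous_id)).continuousOn))
  · filter_upwards [Metric.ball_mem_nhds x₀ one_pos] with x hx
    refine ae_of_all _ fun z ↦ ?_
    rw [Real.norm_eq_abs]
    refine abs_vtranslated_le η (le_max_right _ _) (fun y hy r α hα ↦ (hW y hy r α hα).trans (le_max_left _ _))
      hgR hgM ?_ z a
    rw [mem_ball, dist_eq_norm] at hx
    have := norm_le_insert' x x₀
    linarith
  · filter_upwards [compl_zero_mem_ae] with z hz
    have hn : 0 < ‖z‖ := norm_pos_iff.2 (mem_compl_singleton_iff.1 hz)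
    have hα : ‖‖z‖⁻¹ • z‖ = 1 := by rw [norm_smul, norm_inv, norm_norm, inv_mul_cancel₀ hn.ne']
    exact ((((continuous_bogovskiiWeight_base hη hR hα ‖z‖).comp (continuous_id.sub continuous_const)).mul
      continuous_const).mul (hg.comp (continuous_id.sub continuous_const))).continuousAt

/-- **Bound for the derivative integrand** `z_a/|z|³ (w_{x−z} Df(x − z) + f(x − z) D_y w_{x−z})`, uniformly over
`|x| ≤ X`: `≤ C 𝟙_{|z| ≤ D}/|z|`. [folklore] -/
theorem exists_norm_vderivIntegrand_le (hη : ContDiff ℝ 1 η) (hR : ∀ z : E3, R < ‖z‖ → η z = 0)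
    (hf : ContDiff ℝ 1 f) (hfc : HasCompactSupport f) (a : Fin 3) (X : ℝ) :
    ∃ C D : ℝ, 0 ≤ C ∧ ∀ x : E3, ‖x‖ ≤ X → ∀ z : E3,
      ‖(z a * (‖z‖ ^ 3)⁻¹) • (bogovskiiWeight η (x - z) ‖z‖ (‖z‖⁻¹ • z) • fderiv ℝ f (x - z) +
          f (x - z) • ∫ s in Ioi ‖z‖, (s ^ 2) • fderiv ℝ η (s • (‖z‖⁻¹ • z) + (x - z)))‖ ≤
        (closedBall (0 : E3) D).indicator (fun z ↦ C * (‖z‖ ^ 2)⁻¹) z := by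
  have hηc : Continuous η := hη.continuous
  have hfcn : Continuous f := hf.continuous
  have hdf : Continuous (fderiv ℝ f) := hf.continuous_fderiv one_ne_zero
  obtain ⟨Rf, Mf, hfR, hts, hfM⟩ := exists_radius_bound hfcn hfc
  obtain ⟨Mdf, hMdf⟩ := hdf.bounded_above_of_compact_support (hfc.fderiv (𝕜 := ℝ))
  obtain ⟨W, hW⟩ := exists_abs_bogovskiiWeight_le_of_norm_le hηc hR Rf
  obtain ⟨W', hW'⟩ := exists_norm_fderivWeight_le_of_norm_le hη hR Rf
  have hMf0 : 0 ≤ Mf := (abs_nonneg _).trans (hfM 0)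
  have hMdf0 : 0 ≤ Mdf := (norm_nonneg _).trans (hMdf 0)
  have hdfR : ∀ y, fderiv ℝ f y ≠ 0 → ‖y‖ ≤ Rf := fun y hy ↦ by
    have := hts (support_fderiv_subset ℝ (mem_support.2 hy))
    rwa [mem_closedBall, dist_zero_right] at this
  refine ⟨max W 0 * Mdf + Mf * max W' 0, X + Rf, by positivity, fun x hxX z ↦ ?_⟩
  by_cases h0 : f (x - z) = 0 ∧ fderiv ℝ f (x - z) = 0
  · rw [h0.1, h0.2, smul_zero, zero_smul, add_zero, smul_zero, norm_zero]
    exact indicator_nonneg (fun z _ ↦ by positivity) _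
  have hy : ‖x - z‖ ≤ Rf := by
    rcases not_and_or.1 h0 with h1 | h1
    · exact hfR _ h1
    · exact hdfR _ h1
  rw [indicator_of_mem (mem_closedBall_of_norm_sub_le hxX hy)]
  by_cases hz : z = 0
  · subst hz
    simp only [PiLp.zero_apply, zero_mul, zero_smul, norm_zero]
    positivity
  have hn : 0 < ‖z‖ := norm_pos_iff.2 hz
  have hα : ‖‖z‖⁻¹ • z‖ = 1 := by rw [norm_smul, norm_inv, norm_norm, inv_mul_cancel₀ hn.ne']
  have hw : |bogovskiiWeight η (x - z) ‖z‖ (‖z‖⁻¹ • z)| ≤ max W 0 := (hW _ hy _ _ hα).trans (le_max_left _ _)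
  have hw' : ‖∫ s in Ioi ‖z‖, (s ^ 2) • fderiv ℝ η (s • (‖z‖⁻¹ • z) + (x - z))‖ ≤ max W' 0 :=
    (hW' _ hy _ _ hα).trans (le_max_left _ _)
  rw [norm_smul, Real.norm_eq_abs]
  calc |z a * (‖z‖ ^ 3)⁻¹| * ‖bogovskiiWeight η (x - z) ‖z‖ (‖z‖⁻¹ • z) • fderiv ℝ f (x - z) +
          f (x - z) • ∫ s in Ioi ‖z‖, (s ^ 2) • fderiv ℝ η (s • (‖z‖⁻¹ • z) + (x - z))‖
      ≤ (‖z‖ ^ 2)⁻¹ * (max W 0 * Mdf + Mf * max W' 0) := by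
        refine mul_le_mul (abs_vkernel_le z a) ((norm_add_le _ _).trans (add_le_add ?_ ?_))
          (norm_nonneg _) (by positivity)
        · rw [norm_smul, Real.norm_eq_abs]
          exact mul_le_mul hw (hMdf _) (norm_nonneg _) (le_max_right _ _)
        · rw [norm_smul, Real.norm_eq_abs]
          exact mul_le_mul (hfM _) hw' (norm_nonneg _) hMf0
    _ = (max W 0 * Mdf + Mf * max W' 0) * (‖z‖ ^ 2)⁻¹ := by ring

/-- The derivative integrand is continuous in `z` off `z = 0` (hence a.e.-strongly measurable). [folklore] -/
theorem continuousOn_vderivIntegrand (hη : ContDiff ℝ 1 η) (hR : ∀ z : E3, R < ‖z‖ → η z = 0)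
    (hf : ContDiff ℝ 1 f) (a : Fin 3) (x : E3) :
    ContinuousOn (fun z : E3 ↦ (z a * (‖z‖ ^ 3)⁻¹) •
      (bogovskiiWeight η (x - z) ‖z‖ (‖z‖⁻¹ • z) • fderiv ℝ f (x - z) +
        f (x - z) • ∫ s in Ioi ‖z‖, (s ^ 2) • fderiv ℝ η (s • (‖z‖⁻¹ • z) + (x - z)))) {0}ᶜ :=
  (continuousOn_vkernel a).smul (((continuousOn_weight_translated hη.continuous hR x).smul
    (((hf.continuous_fderiv one_ne_zero).comp (continuous_const.sub continuous_id)).continuousOn)).add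
    (((hf.continuous.comp (continuous_const.sub continuous_id)).continuousOn).smul
      (continuousOn_fderivWeight_translated hη hR x)))

/-- The derivative integrand is continuous in `x` for `z ≠ 0`. [folklore] -/
theorem continuous_vderivIntegrand_base (hη : ContDiff ℝ 1 η) (hR : ∀ z : E3, R < ‖z‖ → η z = 0)
    (hf : ContDiff ℝ 1 f) (a : Fin 3) {z : E3} (hz : z ≠ 0) :
    Continuous (fun x : E3 ↦ (z a * (‖z‖ ^ 3)⁻¹) •
      (bogovskiiWeight η (x - z) ‖z‖ (‖z‖⁻¹ • z) • fderiv ℝ f (x - z) +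
        f (x - z) • ∫ s in Ioi ‖z‖, (s ^ 2) • fderiv ℝ η (s • (‖z‖⁻¹ • z) + (x - z)))) := by
  have hn : 0 < ‖z‖ := norm_pos_iff.2 hz
  have hα : ‖‖z‖⁻¹ • z‖ = 1 := by rw [norm_smul, norm_inv, norm_norm, inv_mul_cancel₀ hn.ne']
  have hs : Continuous fun x : E3 ↦ x - z := continuous_id.sub continuous_const
  have hin : Continuous fun x : E3 ↦ bogovskiiWeight η (x - z) ‖z‖ (‖z‖⁻¹ • z) • fderiv ℝ f (x - z) +
      f (x - z) • ∫ s in Ioi ‖z‖, (s ^ 2) • fderiv ℝ η (s • (‖z‖⁻¹ • z) + (x - z)) :=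
    (((continuous_bogovskiiWeight_base hη.continuous hR hα ‖z‖).comp hs).smul
      ((hf.continuous_fderiv one_ne_zero).comp hs)).add ((hf.continuous.comp hs).smul
        ((continuous_fderivWeight_base hη hR hα ‖z‖).comp hs))
  exact hin.const_smul (z a * (‖z‖ ^ 3)⁻¹)

/-- The derivative integrand is integrable. [folklore] -/
theorem integrable_vderivIntegrand (hη : ContDiff ℝ 1 η) (hR : ∀ z : E3, R < ‖z‖ → η z = 0)
    (hf : ContDiff ℝ 1 f) (hfc : HasCompactSupport f) (a : Fin 3) (x : E3) :
    Integrable fun z : E3 ↦ (z a * (‖z‖ ^ 3)⁻¹) •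
      (bogovskiiWeight η (x - z) ‖z‖ (‖z‖⁻¹ • z) • fderiv ℝ f (x - z) +
        f (x - z) • ∫ s in Ioi ‖z‖, (s ^ 2) • fderiv ℝ η (s • (‖z‖⁻¹ • z) + (x - z))) := by
  obtain ⟨C, D, -, hCD⟩ := exists_norm_vderivIntegrand_le hη hR hf hfc a ‖x‖
  exact (integrable_indicator_inv_norm_sq C D).mono'
    (aestronglyMeasurable_of_continuousOn_compl_zero (continuousOn_vderivIntegrand hη hR hf a x))
    (ae_of_all _ fun z ↦ hCD x le_rfl z)

/-- **`SV_η f` is differentiable, with derivative under the integral sign** (translated form): for `η, f ∈ C¹_c`,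
`D(SV_η f)^{a}(x₀) = ∫ z_a/|z|³ ( w_{x₀−z} Df(x₀ − z) + f(x₀ − z) D_y w_{x₀−z} ) dz`.
[cite: MaoOhTao2023, Lemma 2.3] -/
theorem hasFDerivAt_bogovskiiVOperator (hη : ContDiff ℝ 1 η) (hR : ∀ z : E3, R < ‖z‖ → η z = 0)
    (hf : ContDiff ℝ 1 f) (hfc : HasCompactSupport f) (a : Fin 3) (x₀ : E3) :
    HasFDerivAt (fun x : E3 ↦ ∫ y : E3, bogovskiiWeight η y ‖x - y‖ (‖x - y‖⁻¹ • (x - y)) *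
        ((x - y) a * (‖x - y‖ ^ 3)⁻¹) * f y)
      (∫ z : E3, (z a * (‖z‖ ^ 3)⁻¹) •
        (bogovskiiWeight η (x₀ - z) ‖z‖ (‖z‖⁻¹ • z) • fderiv ℝ f (x₀ - z) +
          f (x₀ - z) • ∫ s in Ioi ‖z‖, (s ^ 2) • fderiv ℝ η (s • (‖z‖⁻¹ • z) + (x₀ - z)))) x₀ := by
  have hηc : Continuous η := hη.continuous
  have hfcn : Continuous f := hf.continuous
  -- translated form, reassociated as `K(z) * (w * f)`
  set F : E3 → E3 → ℝ := fun x z ↦ (z a * (‖z‖ ^ 3)⁻¹) *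
    (bogovskiiWeight η (x - z) ‖z‖ (‖z‖⁻¹ • z) * f (x - z)) with hF
  set F' : E3 → E3 → (E3 →L[ℝ] ℝ) := fun x z ↦ (z a * (‖z‖ ^ 3)⁻¹) •
    (bogovskiiWeight η (x - z) ‖z‖ (‖z‖⁻¹ • z) • fderiv ℝ f (x - z) +
      f (x - z) • ∫ s in Ioi ‖z‖, (s ^ 2) • fderiv ℝ η (s • (‖z‖⁻¹ • z) + (x - z))) with hF'
  have hfun : (fun x : E3 ↦ ∫ y : E3, bogovskiiWeight η y ‖x - y‖ (‖x - y‖⁻¹ • (x - y)) *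
      ((x - y) a * (‖x - y‖ ^ 3)⁻¹) * f y) = fun x ↦ ∫ z, F x z := by
    funext x
    rw [bogovskiiVOperator_eq_translated]
    refine integral_congr_ae (ae_of_all _ fun z ↦ ?_)
    simp only [hF]
    ring
  rw [hfun]
  show HasFDerivAt (fun x ↦ ∫ z, F x z) (∫ z, F' x₀ z) x₀
  obtain ⟨C, D, -, hCD⟩ := exists_norm_vderivIntegrand_le hη hR hf hfc a (‖x₀‖ + 1)
  have hF_meas : ∀ᶠ x in 𝓝 x₀, AEStronglyMeasurable (F x) volume :=
    Eventually.of_forall fun x ↦ aestronglyMeasurable_of_continuousOn_compl_zero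
      ((continuousOn_vkernel a).mul ((continuousOn_weight_translated hηc hR x).mul
        ((hfcn.comp (continuous_const.sub continuous_id)).continuousOn)))
  have hF_int : Integrable (F x₀) := by
    refine (integrable_vtranslated hηc hR hfcn hfc x₀ a).congr (ae_of_all _ fun z ↦ ?_)
    simp only [hF]
    ring
  have hF'_meas : AEStronglyMeasurable (F' x₀) volume :=
    aestronglyMeasurable_of_continuousOn_compl_zero (continuousOn_vderivIntegrand hη hR hf a x₀)
  have h_bound : ∀ᵐ z ∂(volume : Measure E3), ∀ x ∈ ball x₀ 1,
      ‖F' x z‖ ≤ (closedBall (0 : E3) D).indicator (fun z ↦ C * (‖z‖ ^ 2)⁻¹) z := by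
    refine ae_of_all _ fun z x hx ↦ hCD x ?_ z
    rw [mem_ball, dist_eq_norm] at hx
    have := norm_le_insert' x x₀
    linarith
  have h_diff : ∀ᵐ z ∂(volume : Measure E3), ∀ x ∈ ball x₀ 1, HasFDerivAt (F · z) (F' x z) x := by
    filter_upwards [compl_zero_mem_ae] with z hz
    intro x _
    have hn : 0 < ‖z‖ := norm_pos_iff.2 (mem_compl_singleton_iff.1 hz)
    have hα : ‖‖z‖⁻¹ • z‖ = 1 := by rw [norm_smul, norm_inv, norm_norm, inv_mul_cancel₀ hn.ne']
    have hsub : HasFDerivAt (fun x : E3 ↦ x - z) (ContinuousLinearMap.id ℝ E3) x := (hasFDerivAt_id x).sub_const z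
    have h1 : HasFDerivAt (fun x : E3 ↦ bogovskiiWeight η (x - z) ‖z‖ (‖z‖⁻¹ • z))
        (∫ s in Ioi ‖z‖, (s ^ 2) • fderiv ℝ η (s • (‖z‖⁻¹ • z) + (x - z))) x := by
      have h := (hasFDerivAt_bogovskiiWeight_base hη hR hα ‖z‖ (x - z)).comp x hsub
      rwa [ContinuousLinearMap.comp_id] at h
    have h2 : HasFDerivAt (fun x : E3 ↦ f (x - z)) (fderiv ℝ f (x - z)) x := by
      have h := ((hf.differentiable one_ne_zero) (x - z)).hasFDerivAt.comp x hsub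
      rwa [ContinuousLinearMap.comp_id] at h
    have h3 := (h1.mul h2).const_mul (z a * (‖z‖ ^ 3)⁻¹)
    simp only [hF, hF']
    exact h3
  exact hasFDerivAt_integral_of_dominated_of_fderiv_le (ball_mem_nhds x₀ one_pos) hF_meas hF_int hF'_meas h_bound
    (integrable_indicator_inv_norm_sq C D) h_diff

/-- `SV_η f` is differentiable for `η, f ∈ C¹_c`. [cite: MaoOhTao2023, Lemma 2.3] -/
theorem differentiable_bogovskiiVOperator (hη : ContDiff ℝ 1 η) (hR : ∀ z : E3, R < ‖z‖ → η z = 0)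
    (hf : ContDiff ℝ 1 f) (hfc : HasCompactSupport f) (a : Fin 3) :
    Differentiable ℝ fun x : E3 ↦ ∫ y : E3, bogovskiiWeight η y ‖x - y‖ (‖x - y‖⁻¹ • (x - y)) *
      ((x - y) a * (‖x - y‖ ^ 3)⁻¹) * f y :=
  fun x ↦ (hasFDerivAt_bogovskiiVOperator hη hR hf hfc a x).differentiableAt

/-- The derivative `x ↦ D(SV_η f)^{a}(x)` is continuous. [folklore] -/
theorem continuous_integral_vderivIntegrand (hη : ContDiff ℝ 1 η) (hR : ∀ z : E3, R < ‖z‖ → η z = 0)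
    (hf : ContDiff ℝ 1 f) (hfc : HasCompactSupport f) (a : Fin 3) :
    Continuous fun x : E3 ↦ ∫ z : E3, (z a * (‖z‖ ^ 3)⁻¹) •
      (bogovskiiWeight η (x - z) ‖z‖ (‖z‖⁻¹ • z) • fderiv ℝ f (x - z) +
        f (x - z) • ∫ s in Ioi ‖z‖, (s ^ 2) • fderiv ℝ η (s • (‖z‖⁻¹ • z) + (x - z))) := by
  refine continuous_iff_continuousAt.2 fun x₀ ↦ ?_
  obtain ⟨C, D, -, hCD⟩ := exists_norm_vderivIntegrand_le hη hR hf hfc a (‖x₀‖ + 1)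
  refine continuousAt_of_dominated (bound := fun z ↦ (closedBall (0 : E3) D).indicator (fun z ↦ C * (‖z‖ ^ 2)⁻¹) z)
    (Eventually.of_forall fun x ↦ aestronglyMeasurable_of_continuousOn_compl_zero
      (continuousOn_vderivIntegrand hη hR hf a x)) ?_ (integrable_indicator_inv_norm_sq C D) ?_
  · filter_upwards [Metric.ball_mem_nhds x₀ one_pos] with x hx
    refine ae_of_all _ fun z ↦ hCD x ?_ z
    rw [mem_ball, dist_eq_norm] at hx
    have := norm_le_insert' x x₀
    linarith
  · filter_upwards [compl_zero_mem_ae] with z hz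
    exact (continuous_vderivIntegrand_base hη hR hf a (mem_compl_singleton_iff.1 hz)).continuousAt

/-- **`SV_η f ∈ C¹`** for `η, f ∈ C¹_c`. [cite: MaoOhTao2023, Lemma 2.3] -/
theorem contDiff_one_bogovskiiVOperator (hη : ContDiff ℝ 1 η) (hR : ∀ z : E3, R < ‖z‖ → η z = 0)
    (hf : ContDiff ℝ 1 f) (hfc : HasCompactSupport f) (a : Fin 3) :
    ContDiff ℝ 1 fun x : E3 ↦ ∫ y : E3, bogovskiiWeight η y ‖x - y‖ (‖x - y‖⁻¹ • (x - y)) *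
      ((x - y) a * (‖x - y‖ ^ 3)⁻¹) * f y := by
  refine contDiff_one_iff_fderiv.2 ⟨differentiable_bogovskiiVOperator hη hR hf hfc a, ?_⟩
  have hfd : fderiv ℝ (fun x : E3 ↦ ∫ y : E3, bogovskiiWeight η y ‖x - y‖ (‖x - y‖⁻¹ • (x - y)) *
      ((x - y) a * (‖x - y‖ ^ 3)⁻¹) * f y) = fun x ↦ ∫ z : E3, (z a * (‖z‖ ^ 3)⁻¹) •
      (bogovskiiWeight η (x - z) ‖z‖ (‖z‖⁻¹ • z) • fderiv ℝ f (x - z) +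
        f (x - z) • ∫ s in Ioi ‖z‖, (s ^ 2) • fderiv ℝ η (s • (‖z‖⁻¹ • z) + (x - z))) :=
    funext fun x ↦ (hasFDerivAt_bogovskiiVOperator hη hR hf hfc a x).fderiv
  rw [hfd]
  exact continuous_integral_vderivIntegrand hη hR hf hfc a

/-- **The partial derivatives of `SV_η f`**: for `η, f ∈ C¹_c`,
`∂_m (SV_η f)^{a} = (SV_{∂_mη} f)^{a} + (SV_η ∂_m f)^{a}` — the derivative falls on the base point of the weight
(producing the same operator with cut-off `∂_mη`) and on `f`. [cite: MaoOhTao2023, Lemma 2.3] -/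
theorem pd_bogovskiiVOperator (hη : ContDiff ℝ 1 η) (hR : ∀ z : E3, R < ‖z‖ → η z = 0)
    (hf : ContDiff ℝ 1 f) (hfc : HasCompactSupport f) (a m : Fin 3) (x : E3) :
    pd m (fun x : E3 ↦ ∫ y : E3, bogovskiiWeight η y ‖x - y‖ (‖x - y‖⁻¹ • (x - y)) *
        ((x - y) a * (‖x - y‖ ^ 3)⁻¹) * f y) x =
      (∫ y : E3, bogovskiiWeight (pd m η) y ‖x - y‖ (‖x - y‖⁻¹ • (x - y)) *
        ((x - y) a * (‖x - y‖ ^ 3)⁻¹) * f y) +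
      ∫ y : E3, bogovskiiWeight η y ‖x - y‖ (‖x - y‖⁻¹ • (x - y)) *
        ((x - y) a * (‖x - y‖ ^ 3)⁻¹) * pd m f y := by
  have hηc : Continuous η := hη.continuous
  have hfcn : Continuous f := hf.continuous
  have hpdf : Continuous (pd m f) := by
    unfold pd; exact (hf.continuous_fderiv one_ne_zero).clm_apply continuous_const
  have hpdfc : HasCompactSupport (pd m f) := by
    unfold pd; exact hfc.fderiv_apply (𝕜 := ℝ) (e m)
  have hpdη : Continuous (pd m η) := continuous_pd_eta hη m
  have hpdηR : ∀ z : E3, R < ‖z‖ → pd m η z = 0 := fun z hz ↦ pd_eq_zero_of_norm_lt hR m z hz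
  unfold pd
  rw [(hasFDerivAt_bogovskiiVOperator hη hR hf hfc a x).fderiv,
    ContinuousLinearMap.integral_apply (integrable_vderivIntegrand hη hR hf hfc a x) (e m)]
  -- evaluate the integrand at `e m` (off `z = 0`)
  have hev : (fun z : E3 ↦ ((z a * (‖z‖ ^ 3)⁻¹) •
      (bogovskiiWeight η (x - z) ‖z‖ (‖z‖⁻¹ • z) • fderiv ℝ f (x - z) +
        f (x - z) • ∫ s in Ioi ‖z‖, (s ^ 2) • fderiv ℝ η (s • (‖z‖⁻¹ • z) + (x - z)))) (e m)) =ᵐ[volume]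
      fun z ↦ bogovskiiWeight (fun y ↦ fderiv ℝ η y (e m)) (x - z) ‖z‖ (‖z‖⁻¹ • z) *
          (z a * (‖z‖ ^ 3)⁻¹) * f (x - z) +
        bogovskiiWeight η (x - z) ‖z‖ (‖z‖⁻¹ • z) * (z a * (‖z‖ ^ 3)⁻¹) *
          fderiv ℝ f (x - z) (e m) := by
    filter_upwards [compl_zero_mem_ae] with z hz
    have hn : 0 < ‖z‖ := norm_pos_iff.2 (mem_compl_singleton_iff.1 hz)
    have hα : ‖‖z‖⁻¹ • z‖ = 1 := by rw [norm_smul, norm_inv, norm_norm, inv_mul_cancel₀ hn.ne']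
    simp only [FunLike.coe_smul, add_apply, Pi.smul_apply, smul_eq_mul]
    rw [fderivWeight_apply_e hη hR hα]
    unfold pd
    ring
  rw [integral_congr_ae hev]
  have hI1 := integrable_vtranslated hpdη hpdηR hfcn hfc x a
  have hI2 := integrable_vtranslated hηc hR hpdf hpdfc x a
  unfold pd at hI1 hI2
  rw [integral_add hI1 hI2, bogovskiiVOperator_eq_translated, bogovskiiVOperator_eq_translated]


end MaoOhTao

end Literature.Geometry.Lorentzian

end
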